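import Summits.AtomisticToContinuum.Crystallization.Theorems.HullExactificationCascadeRobustBarlowTemplateDefs

/-!
# Line `registered` (crux `RobustBarlowTemplate`, stmt-AtomisticToContinuum-12088): the refined Barlow honeycomb (definitions)

Definitions (D-0016: reviewed; lemmas live in the sibling proof files
`HullExactificationCascadeRobustBarlowTemplateHoneycomb*.lean`) for the stub `develop_injective` of the line
`Cruxes/RobustBarlowTemplate/Lines/birth.lean`: the development `Ψ` of the ideal stacking
`idealStacking s = barlowStacking 1 √(2/3) s` into `S` is extended PIECEWISE-AFFINELY over the cells of the
tetrahedral–octahedral honeycomb of the stacking (octahedra cut into four "quarters" along a fixed diagonal),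
and the extension is shown to be a covering map of `ℝ³` (`develop_coveringCriterion`), hence injective.

SKEW COORDINATES.  Slab `k` (between the layers `k` and `k+1`, letter `σ = s k = ±1`) carries the affine
frame based at the site `barlowPos 1 h s k 0 0` with vectors `σ•u, σ•v` (in-layer, `u = triangularVec₁ 1`,
`v = triangularVec₂ 1`) and the RISE VECTOR `σ•w + h•e₃` (`w = barlowOffset 1`, `h = √(2/3)`; a unit vector
joining a site of layer `k` to a site of layer `k+1`).  All three frame vectors are unit with pairwise inner
products `1/2`, for both signs `σ`, so every slab looks the same in its skew coordinates `(α, β, θ)`,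
`θ ∈ [0,1]`: the sites of layer `k` sit at `(i, j, 0)` and those of layer `k+1` at `(i, j, 1)`
(`skewSite`), and the cells of the honeycomb in the slab are cut out by `α ∈ ℤ`, `β ∈ ℤ`, `α+β+θ ∈ ℤ`:
with `a, b` the fractional parts of `α, β` and `m = ⌊a+b+θ⌋ ∈ {0,1,2}` the cell through the point is the
tetrahedron `T↑ = {(0,0,0),(1,0,0),(0,1,0),(0,0,1)}` (`m = 0`), the tetrahedron
`T↓ = {(1,1,0),(1,0,1),(0,1,1),(1,1,1)}` (`m = 2`), or (`m = 1`) one of the four quarters of the octahedron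
`{A=(1,0,0), B=(0,1,0), C=(1,1,0), D=(0,0,1), E=(1,0,1), F=(0,1,1)}` around its diagonal `C–D`, separated by
the planes `β+θ = 1` (through `C,D,B,E`) and `α+θ = 1` (through `C,D,A,F`) — all coordinates relative to
`(⌊α⌋, ⌊β⌋, 0)`.  The barycentric weights are explicit affine functions of `(a, b, θ)` (`plData`).

* `hB` — the layer spacing `√(2/3)`;
* `skewU s k`, `skewV s k`, `riseVec s k`, `slabBase s k` — the frame of slab `k`;
* `ofSkew s k c`, `toSkew s k x` — skew coordinates of slab `k` and their (explicit) inverse;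
* `skewSite s k p q r` — the site with integer skew coordinates `(p, q, r)`, `r ∈ {0, 1}`, of slab `k`,
  as a layer/row/column index triple `(k + r, σ p, σ q)` of `barlowPos 1 hB s`;
* `slabOf x = ⌊x₃ / h⌋` — the slab of a point;
* `plData s x` — POINT LOCATION: the four sites (index triples) of the cell through `x` and the four
  barycentric weights of `x` in it;
* `plExtend s g x = Σ_m weightₘ • g(siteₘ)` — the PIECEWISE-AFFINE EXTENSION of vertex data `g` (any real
  vector space of values; with `g (k,i,j) = Ψ (barlowPos 1 hB s k i j)` this is the extension of the
  development, with `g` an indicator it is the hat function of a site).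

All `[folklore]` (the tetrahedral–octahedral honeycomb / "octet truss" of a close-packed stacking, HalesDSP2012
§1.3, in explicit coordinates; piecewise-linear interpolation).
-/

noncomputable section

namespace Summit.AtomisticToContinuum.Crystallization.Theorems.HullExactificationCascadeRobustBarlowTemplate

open Literature.MathematicalPhysics.StatisticalMechanics

/-- Euclidean `3`-space. -/
local notation "E3" => EuclideanSpace ℝ (Fin 3)

/-- The layer spacing `h = √(2/3)` of the ideal stacking `idealStacking s = barlowStacking 1 h s`. [folklore] -/
def hB : ℝ := Real.sqrt (2 / 3)

/-- First in-layer frame vector of slab `k`: `σ_k • u`. [folklore] -/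
def skewU (s : ℤ → ℤ) (k : ℤ) : E3 := (s k : ℝ) • triangularVec₁ 1

/-- Second in-layer frame vector of slab `k`: `σ_k • v`. [folklore] -/
def skewV (s : ℤ → ℤ) (k : ℤ) : E3 := (s k : ℝ) • triangularVec₂ 1

/-- The RISE VECTOR of slab `k`: `σ_k • w + h • e₃`, joining the site `(k, i, j)` to the site `(k+1, i, j)`
(a unit vector for a Hägg letter `σ_k = ±1`). [folklore] -/
def riseVec (s : ℤ → ℤ) (k : ℤ) : E3 := (s k : ℝ) • barlowOffset 1 + layerNormal hB

/-- The base point of slab `k`: the site `barlowPos 1 h s k 0 0 = (haggLabel s k) • w + k • (h e₃)`. [folklore] -/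
def slabBase (s : ℤ → ℤ) (k : ℤ) : E3 := barlowPos 1 hB s k 0 0

/-- Skew coordinates `c = (α, β, θ)` of slab `k` ↦ the point `base + α σu + β σv + θ (σw + h e₃)`. [folklore] -/
def ofSkew (s : ℤ → ℤ) (k : ℤ) (c : Fin 3 → ℝ) : E3 :=
  slabBase s k + c 0 • skewU s k + c 1 • skewV s k + c 2 • riseVec s k

/-- The skew coordinates of a point in the frame of slab `k` (explicit inverse of `ofSkew s k` when
`s k = ±1`): `θ = (x₃ − k h)/h`, and with `y = x − base − θ • rise = σ(α u + β v)`: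
`β = σ (2/√3) y₂`, `α = σ y₁ − β/2`. [folklore] -/
def toSkew (s : ℤ → ℤ) (k : ℤ) (x : E3) : Fin 3 → ℝ :=
  let θ : ℝ := (x 2 - k * hB) / hB
  let y : E3 := x - slabBase s k - θ • riseVec s k
  let β : ℝ := (s k : ℝ) * (2 / Real.sqrt 3) * y 1
  let α : ℝ := (s k : ℝ) * y 0 - β / 2
  ![α, β, θ]

/-- The site of slab `k` with INTEGER skew coordinates `(p, q, r)` (`r = 0`: layer `k`; `r = 1`: layer
`k + 1`), as an index triple `(layer, i, j)` of `barlowPos 1 hB s`: `(k + r, σ_k p, σ_k q)`. [folklore] -/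
def skewSite (s : ℤ → ℤ) (k p q r : ℤ) : ℤ × ℤ × ℤ := (k + r, s k * p, s k * q)

/-- The site with index triple `t = (k, i, j)`. [folklore] -/
def siteAt (s : ℤ → ℤ) (t : ℤ × ℤ × ℤ) : E3 := barlowPos 1 hB s t.1 t.2.1 t.2.2

/-- The slab of a point: `⌊x₃ / h⌋`. [folklore] -/
def slabOf (x : E3) : ℤ := ⌊x 2 / hB⌋

/-- POINT LOCATION in the refined honeycomb: the four sites (index triples) of the closed cell through `x`
chosen by the sign tests below, and the barycentric weights of `x` in that cell (affine in the local skew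
coordinates `a, b, θ`).  Regions of slab `k`, relative to `(⌊α⌋, ⌊β⌋, 0)`: `a+b+θ ≤ 1`: tetrahedron
`T↑ = (0,0,0),(1,0,0),(0,1,0),(0,0,1)` with weights `(1−a−b−θ, a, b, θ)`; `2 ≤ a+b+θ`: tetrahedron
`T↓ = (1,1,0),(1,0,1),(0,1,1),(1,1,1)` with weights `(1−θ, 1−b, 1−a, a+b+θ−2)`; otherwise the quarter of the
octahedron through its diagonal `C=(1,1,0), D=(0,0,1)` selected by the signs of `b+θ−1`, `a+θ−1`:
`{C,D,A,B}` (`≤,≤`; weights `(a+b+θ−1, θ, 1−b−θ, 1−a−θ)`), `{C,D,E,A}` (`≤,>`; `(b, 1−a, a+θ−1, 1−b−θ)`),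
`{C,D,B,F}` (`>,≤`; `(a, 1−b, 1−a−θ, b+θ−1)`), `{C,D,F,E}` (`>,>`; `(1−θ, 2−a−b−θ, b+θ−1, a+θ−1)`), where
`A=(1,0,0), B=(0,1,0), E=(1,0,1), F=(0,1,1)`. [folklore] -/
def plData (s : ℤ → ℤ) (x : E3) : (Fin 4 → ℤ × ℤ × ℤ) × (Fin 4 → ℝ) :=
  let k : ℤ := slabOf x
  let c : Fin 3 → ℝ := toSkew s k x
  let i : ℤ := ⌊c 0⌋
  let j : ℤ := ⌊c 1⌋
  let a : ℝ := c 0 - i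
  let b : ℝ := c 1 - j
  let θ : ℝ := c 2
  let v : ℤ → ℤ → ℤ → ℤ × ℤ × ℤ := fun p q r => skewSite s k (i + p) (j + q) r
  if a + b + θ ≤ 1 then
    (![v 0 0 0, v 1 0 0, v 0 1 0, v 0 0 1], ![1 - a - b - θ, a, b, θ])
  else if 2 ≤ a + b + θ then
    (![v 1 1 0, v 1 0 1, v 0 1 1, v 1 1 1], ![1 - θ, 1 - b, 1 - a, a + b + θ - 2])
  else if b + θ ≤ 1 then
    (if a + θ ≤ 1 then
      (![v 1 1 0, v 0 0 1, v 1 0 0, v 0 1 0], ![a + b + θ - 1, θ, 1 - b - θ, 1 - a - θ])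
    else
      (![v 1 1 0, v 0 0 1, v 1 0 1, v 1 0 0], ![b, 1 - a, a + θ - 1, 1 - b - θ]))
  else
    (if a + θ ≤ 1 then
      (![v 1 1 0, v 0 0 1, v 0 1 0, v 0 1 1], ![a, 1 - b, 1 - a - θ, b + θ - 1])
    else
      (![v 1 1 0, v 0 0 1, v 0 1 1, v 1 0 1], ![1 - θ, 2 - a - b - θ, b + θ - 1, a + θ - 1]))

/-- The PIECEWISE-AFFINE EXTENSION over the refined honeycomb of vertex data `g` (indexed by site index
triples, with values in any real vector space): `Σ_m weightₘ(x) • g(siteₘ(x))`.  With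
`g t = Ψ (siteAt s t)` this extends the development `Ψ`; with `g` the indicator of one index triple it is
the hat function of that site. [folklore] -/
def plExtend (s : ℤ → ℤ) {W : Type*} [AddCommGroup W] [Module ℝ W] (g : ℤ × ℤ × ℤ → W) (x : E3) : W :=
  ∑ m : Fin 4, (plData s x).2 m • g ((plData s x).1 m)

/-- Anchor (registered sub-goal of stmt-AtomisticToContinuum-12088): the barycentric weights of the
tetrahedron `T↑` sum to `1` (sanity of `plData`, region `a+b+θ ≤ 1`). [folklore] -/
theorem plData_weights_up : ∀ (a b θ : ℝ), (1 - a - b - θ) + a + b + θ = 1 := by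
  intro a b θ; ring

end Summit.AtomisticToContinuum.Crystallization.Theorems.HullExactificationCascadeRobustBarlowTemplate

end
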